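import Summits.Schanuel.Schanuel.Theses.RoyCriterion
import Summits.Schanuel.Schanuel.Theses.DiophantineDichotomy
import Summits.Schanuel.Schanuel.Theorems.DiophantineDichotomyKhovanskiiReduction
import Summits.Schanuel.Schanuel.Theorems.RoyThesisTyped.Negative.RankStructure
import Summits.Schanuel.Schanuel.Theorems.RoyCriterionRoyThesisTypedPointwise
import Summits.Schanuel.Schanuel.Theorems.RoyCriterionSchanuelTwoLineSketch
import Summits.Schanuel.Schanuel.Theorems.RoyThesis.Negative.LoadBearing
import Literature.Barriers.Schanuel.LargeTranscendenceDegree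

/-!
# Strategy census (kernel side) for crux `stmt-Schanuel-0463`
`Summit.Schanuel.Schanuel.Theses.RoyCriterion.RoyThesisTyped = ∀ n, RoyCriterion n`

Companion of `Cruxes/RoyThesisTyped/STRATEGY-CENSUS.md` (crux-strategist / wall-breaker seat,
2026-08-17). Everything here is sorry-free; nothing is a registered skeleton (no `stub_*`, no
`RoyThesisTyped_of`). What is kernel-checked:

* §0 THE WALL. `crux_iff_summit`, and its two functorial forms `line_of_route` / `route_of_line`:
  a concluding composition `C₁ → … → C_k → RoyThesisTyped` on this crux and a deciding theorem
  `C₁ → … → C_k → Schanuel` of the summit are the SAME object up to `Roy2001_iff_holds`. Hence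
  every (open or closed) route of the summit is a line on this crux and every new line here is a
  new route of the summit.
* §D1 DECOMPOSITION BY RANK is costume: with `RankStep := ∀ l ≥ 2, SchanuelRank l → SchanuelRank (l+1)`
  the glue `SchanuelTwo → RankStep → RoyThesisTyped` is proved (`crux_of_schanuelTwo_of_rankStep`),
  but `RankStep ↔ (SchanuelTwo → RoyThesisTyped)` (`rankStep_iff_complement`, through the up-set
  theorem `RoyThesisTyped.schanuelRank_anti`): the second child is literally "first child → crux".
* §D2 DECOMPOSITION BY REGIME is genuine but toothless: for ANY predicate `P` on tuples the crux
  splits as `CruxOn P ∧ CruxOn Pᶜ` (`crux_iff_regimes`); for `P =` the Technical Hypothesis of the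
  large-transcendence-degree method (`Literature.Barriers.Schanuel.TechnicalHypothesis`) the
  T.H.-half still contains the flagship instance: `technicalHypothesis_one_piI` (T.H. holds at
  `(1, πi)`, trivially) and `expOnePi_of_cruxOn_technicalHypothesis` (that half ⟹ `e ⊥ π`).
* §D3 DECOMPOSITION BY ATTACHMENT to the mechanism-nearest route (Roy 2001 p.184: Conjecture 2 is
  "similar to the present criteria of algebraic independence [Laurent–Roy, Philippon]" — route
  `DiophantineDichotomy` is the typed Laurent–Roy / GL326-15.31 approximation race):
  `crux_of_diophantineDichotomy : ApproximationProperty → KhovanskiiApproxTypeEv → RoyThesisTyped`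
  (its third hypothesis `KhovanskiiReduction` is the tree theorem `khovanskiiReduction_proof`).
* §S STRENGTHENINGS: the conclusion `l+1` is refuted in tree (`royThesis_conclusion_sharp`,
  restated here for the typed twin as `not_cruxSucc`).
* §T TRANSFER endpoints already in tree, re-exported in the crux's format (LW stratum every rank,
  rank-2 planes through `π`).
-/

set_option linter.dupNamespace false

noncomputable section

namespace Summit.Schanuel.Schanuel.Cruxes.RoyThesisTyped.StrategyCensus

open Complex
open Literature.NumberTheory.Transcendental
open Summit.Schanuel.Schanuel.Theses.RoyCriterion (RoyThesisTyped RoyThesis SchanuelTwo)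
open Summit.Schanuel.Schanuel.Theorems

/-! ## §0 The wall: lines on this crux = routes on the summit -/

/-- The crux is the summit (both directions kernel theorems: `Roy2001_iff_holds`). [cite: Roy2001, §5] -/
theorem crux_iff_summit : RoyThesisTyped ↔ _root_.Schanuel :=
  ⟨fun h n => (Roy2001_iff_holds n).mp (h n), fun h n => (Roy2001_iff_holds n).mpr (h n)⟩

/-- Every deciding theorem `closes : C → Schanuel` of a route of the summit is a concluding
composition `C → RoyThesisTyped` on this crux. [cite: Roy2001, §5] -/
theorem line_of_route {C : Prop} (closes : C → _root_.Schanuel) : C → RoyThesisTyped :=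
  fun h => crux_iff_summit.mpr (closes h)

/-- Conversely every concluding composition on this crux decides the summit. [cite: Roy2001, §5] -/
theorem route_of_line {C : Prop} (line : C → RoyThesisTyped) : C → _root_.Schanuel :=
  fun h => crux_iff_summit.mp (line h)

/-- Two-hypothesis (curried) form of `line_of_route`. [cite: Roy2001, §5] -/
theorem line_of_route₂ {C₁ C₂ : Prop} (closes : C₁ → C₂ → _root_.Schanuel) :
    C₁ → C₂ → RoyThesisTyped :=
  fun h₁ h₂ => crux_iff_summit.mpr (closes h₁ h₂)

/-- Three-hypothesis (curried) form of `line_of_route`. [cite: Roy2001, §5] -/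
theorem line_of_route₃ {C₁ C₂ C₃ : Prop} (closes : C₁ → C₂ → C₃ → _root_.Schanuel) :
    C₁ → C₂ → C₃ → RoyThesisTyped :=
  fun h₁ h₂ h₃ => crux_iff_summit.mpr (closes h₁ h₂ h₃)

/-! ## §D1 Decomposition by rank — glue proved, second child = complement (costume) -/

/-- The rank step above the first open rung. -/
def RankStep : Prop := ∀ l : ℕ, 2 ≤ l → SchanuelRank l → SchanuelRank (l + 1)

/-- Ranks `0, 1` of Roy's criterion are tree theorems. [cite: Roy2001, §1 p.184] -/
theorem royCriterion_of_lt_two {n : ℕ} (hn : n < 2) : RoyCriterion n := by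
  interval_cases n
  · exact royCriterion_zero
  · exact Literature.Transcend.royCriterion_one_of_facts Roy2001_iff_holds transcendental_exp_holds

/-- GLUE of the rank split: `SchanuelTwo → RankStep → RoyThesisTyped` (induction on the rank from
`l = 2`; ranks `0, 1` in tree). [folklore] -/
theorem crux_of_schanuelTwo_of_rankStep (h2 : SchanuelTwo) (hs : RankStep) : RoyThesisTyped := by
  have hS : ∀ l, 2 ≤ l → SchanuelRank l := by
    intro l hl
    induction l, hl using Nat.le_induction with
    | base => exact schanuelTwo_iff_schanuelRank_two.mp h2
    | succ l hl ih => exact hs l hl ih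
  intro n
  by_cases hn : 2 ≤ n
  · exact (Roy2001_iff_holds n).mpr (hS n hn)
  · exact royCriterion_of_lt_two (by omega)

/-- COSTUME CERTIFICATE: the second child of the rank split is EQUIVALENT to "first child → crux"
(`←` uses the up-set structure `RoyThesisTyped.schanuelRank_anti`: `SchanuelRank l`, `l ≥ 2`,
gives `SchanuelRank 2`). So `RoyThesisTyped ⇐ SchanuelTwo ∧ RankStep` is the split `A ∧ (A → X)`.
[folklore] -/
theorem rankStep_iff_complement : RankStep ↔ (SchanuelTwo → RoyThesisTyped) := by
  constructor
  · exact fun hs h2 => crux_of_schanuelTwo_of_rankStep h2 hs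
  · intro h l hl hSl
    have h2 : SchanuelTwo :=
      schanuelTwo_iff_schanuelRank_two.mpr (RoyThesisTyped.schanuelRank_anti hl hSl)
    exact (Roy2001_iff_holds (l + 1)).mp (h h2 (l + 1))

/-! ## §D2 Decomposition by regime — genuine, glue trivial, T.H.-half contains `e ⊥ π` -/

/-- The crux restricted to the tuples satisfying a predicate `P` (Schanuel's inequality there,
in the crux's pointwise format `RoyThesisTyped.crux_iff_pointwise`). -/
def CruxOn (P : ∀ {l : ℕ}, (Fin l → ℂ) → Prop) : Prop :=
  ∀ (l : ℕ) (y : Fin l → ℂ), LinearIndependent ℚ y → P y →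
    (l : Cardinal) ≤ Algebra.trdeg ℚ
      ↥(IntermediateField.adjoin ℚ (Set.range y ∪ Set.range (cexp ∘ y)))

/-- REGIME SPLIT: for every predicate `P` the crux is the conjunction of its restrictions to `P`
and to `¬P` (glue = excluded middle, through the pointwise form of the crux). [folklore] -/
theorem crux_iff_regimes (P : ∀ {l : ℕ}, (Fin l → ℂ) → Prop) :
    RoyThesisTyped ↔ CruxOn P ∧ CruxOn (fun y => ¬ P y) := by
  rw [RoyThesisTyped.crux_iff_pointwise]
  constructor
  · exact fun h => ⟨fun l y hy _ => h l y hy, fun l y hy _ => h l y hy⟩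
  · rintro ⟨hP, hnP⟩ l y hy
    by_cases hPy : P y
    · exact hP l y hy hPy
    · exact hnP l y hy hPy

/-- A non-zero integer linear form in `1, πi` has norm `≥ 1` (real part `h₀`, imaginary part
`h₁π`). [folklore] -/
theorem one_le_norm_intForm_one_piI (h : Fin 2 → ℤ) (hh : h ≠ 0) :
    (1 : ℝ) ≤ ‖∑ i, (h i : ℂ) * (![(1 : ℂ), (Real.pi : ℂ) * I] i)‖ := by
  have hsum : ∑ i, (h i : ℂ) * (![(1 : ℂ), (Real.pi : ℂ) * I] i) =
      (h 0 : ℂ) + (h 1 : ℂ) * ((Real.pi : ℂ) * I) := by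
    simp [Fin.sum_univ_two]
  rw [hsum]
  set z : ℂ := (h 0 : ℂ) + (h 1 : ℂ) * ((Real.pi : ℂ) * I) with hz
  have hre : z.re = (h 0 : ℝ) := by simp [hz]
  have him : z.im = (h 1 : ℝ) * Real.pi := by simp [hz]
  by_cases h1 : h 1 = 0
  · have h0 : h 0 ≠ 0 := by
      intro h0
      apply hh
      ext i; fin_cases i <;> simp [h0, h1]
    have h0' : (1 : ℝ) ≤ |(h 0 : ℝ)| := by
      have : (1 : ℤ) ≤ |h 0| := Int.one_le_abs h0
      exact_mod_cast this
    calc (1 : ℝ) ≤ |(h 0 : ℝ)| := h0'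
      _ = |z.re| := by rw [hre]
      _ ≤ ‖z‖ := Complex.abs_re_le_norm z
  · have h1' : (1 : ℝ) ≤ |(h 1 : ℝ)| := by
      have : (1 : ℤ) ≤ |h 1| := Int.one_le_abs h1
      exact_mod_cast this
    have hpi : (1 : ℝ) ≤ Real.pi := le_of_lt (lt_of_lt_of_le (by norm_num) Real.two_le_pi)
    calc (1 : ℝ) = 1 * 1 := by ring
      _ ≤ |(h 1 : ℝ)| * Real.pi := mul_le_mul h1' hpi zero_le_one (abs_nonneg _)
      _ = |(h 1 : ℝ) * Real.pi| := by
          rw [abs_mul, abs_of_pos Real.pi_pos]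
      _ = |z.im| := by rw [him]
      _ ≤ ‖z‖ := Complex.abs_im_le_norm z

/-- **The Technical Hypothesis holds at the flagship tuple `(1, πi)`** (trivially: every non-zero
integer form in `1, πi` has norm `≥ 1 ≥ exp(−H^ε)`). So the "Diophantine-generic" half of the
regime split still contains the algebraic independence of `e` and `π`.
[cite: NesterenkoPhilippon2001, Ch. 14 Definition 2.6] -/
theorem technicalHypothesis_one_piI :
    Literature.Barriers.Schanuel.TechnicalHypothesis ![(1 : ℂ), (Real.pi : ℂ) * I] := by
  intro ε hε
  refine ⟨1, one_pos, fun H hH h hh _ => ?_⟩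
  have hexp : Real.exp (-(H ^ ε)) ≤ 1 := by
    rw [Real.exp_le_one_iff, neg_nonpos]
    exact Real.rpow_nonneg (le_trans zero_le_one hH) ε
  exact hexp.trans (one_le_norm_intForm_one_piI h hh)

/-- **The T.H.-half of the regime split implies `e ⊥ π`** (apply it at `(1, πi)`, which is
`ℚ`-free (`Literature.Barriers.Schanuel.linearIndependent_one_piI`) and satisfies T.H.
(`technicalHypothesis_one_piI`); then `expOnePiAlgebraicIndependent_of_two_le_trdeg`). Hence that
half is still of Schanuel-rank-2 strength: the split isolates nothing provable.
[cite: BakerTNT1975, Ch. 12 p. 120] -/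
theorem expOnePi_of_cruxOn_technicalHypothesis
    (h : CruxOn (fun y => Literature.Barriers.Schanuel.TechnicalHypothesis y)) :
    ExpOnePiAlgebraicIndependent :=
  expOnePiAlgebraicIndependent_of_two_le_trdeg
    (h 2 _ Literature.Barriers.Schanuel.linearIndependent_one_piI technicalHypothesis_one_piI)

/-! ## §D3 Decomposition by attachment to route `DiophantineDichotomy` (Laurent–Roy race) -/

/-- **The crux from the two open cruxes of route `DiophantineDichotomy`**: Philippon's
approximation property in transcendence degree `t` (`ApproximationProperty`, GL326 Conj. 15.31 /
AP2) and the eventual simultaneous approximation type at free Khovanskii points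
(`KhovanskiiApproxTypeEv`) imply Roy's Conjecture 2 in every rank — through that route's deciding
theorem `closes`, whose third hypothesis `KhovanskiiReduction` is the tree theorem
`khovanskiiReduction_proof` (Ax 1971 + Khovanskii dichotomy), and `Roy2001_iff_holds`.
This is the typed form of Roy 2001 p.184 ("this arithmetic statement is similar to the present
criteria of algebraic independence [Laurent–Roy], [Philippon]; it suggests a reasonable approach").
[cite: Roy2001, §1 p.184] [cite: Waldschmidt2004, §4 (GL326 Conj. 15.31)] -/
theorem crux_of_diophantineDichotomy
    (hAP : Summit.Schanuel.Schanuel.Theses.DiophantineDichotomy.ApproximationProperty)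
    (hEv : Summit.Schanuel.Schanuel.Theses.DiophantineDichotomy.KhovanskiiApproxTypeEv) :
    RoyThesisTyped :=
  line_of_route₃ Summit.Schanuel.Schanuel.Theses.DiophantineDichotomy.closes hAP hEv
    khovanskiiReduction_proof

/-! ## §S Strengthenings -/

/-- The crux with conclusion `l + 1` in place of `l`. -/
def CruxSucc : Prop :=
  ∀ (n : ℕ) (y α : Fin n → ℂ), LinearIndependent ℚ y → (∀ j, α j ≠ 0) →
    ∀ (s₀ s₁ t₀ t₁ u : ℝ), RoyAdmissible s₀ s₁ t₀ t₁ u → RoyHypothesis y α s₀ s₁ t₀ t₁ u →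
      ((n + 1 : ℕ) : Cardinal) ≤
        Algebra.trdeg ℚ ↥(IntermediateField.adjoin ℚ (Set.range y ∪ Set.range α))

/-- **S⁺ = "conclusion `l+1`" is FALSE** (witness `l = 1`, `(y, α) = (1, e)`; tree theorem
`royThesis_conclusion_sharp` of `Theorems/RoyThesis/Negative/LoadBearing.lean`). [folklore] -/
theorem not_cruxSucc : ¬ CruxSucc := RoyThesisNegative.royThesis_conclusion_sharp

/-! ## §T Transfer endpoints (the solved siblings' reach, in the crux's format; all tree theorems) -/

/-- Lindemann–Weierstrass transfer: the crux on the algebraic stratum, EVERY rank. [cite: BakerTNT1975, Ch. 1 Thm 1.4] -/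
example {l : ℕ} (y : Fin l → ℂ) (halg : ∀ j, IsAlgebraic ℚ (y j)) (hy : LinearIndependent ℚ y) :
    (l : Cardinal) ≤ Algebra.trdeg ℚ
      ↥(IntermediateField.adjoin ℚ (Set.range y ∪ Set.range (cexp ∘ y))) :=
  RoyThesisTyped.schanuelRank_of_isAlgebraic y halg hy

/-- Nesterenko transfer: rank 2 of the crux on every `ℚ`-plane through `π`. [cite: NesterenkoPhilippon2001, Ch. 3 Thm 1.1] -/
example : ∀ (y α : Fin 2 → ℂ), (∃ i, y i = Real.pi) → (∀ j, α j ≠ 0) →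
    ∀ (s₀ s₁ t₀ t₁ u : ℝ), RoyAdmissible s₀ s₁ t₀ t₁ u → RoyHypothesis y α s₀ s₁ t₀ t₁ u →
      ((2 : ℕ) : Cardinal) ≤ Algebra.trdeg ℚ ↥(IntermediateField.adjoin ℚ (Set.range y ∪ Set.range α)) :=
  RoyThesisTyped.royCriterion_two_on_piPlanes

end Summit.Schanuel.Schanuel.Cruxes.RoyThesisTyped.StrategyCensus

end
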